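import Summits.Ventures.CertifiedManyBodySolver.Observables.WardBogoliubovBorder
import Literature.MathematicalPhysics.QuantumLattice.FermionTorusTranslationSums
import Literature.MathematicalPhysics.QuantumLattice.DWaveSourceNNNHoppingWindowHamiltonian
import Literature.MathematicalPhysics.QuantumLattice.HubbardNNNHoppingWindowCertificate
import Literature.LinearAlgebra.Matrix.PosSemidefTrace
import Literature.MathematicalPhysics.QuantumLattice.InfVolFermionStateCompactness
import Summits.Ventures.CertifiedManyBodySolver.Rows.SourcedTorusRowsHook
import HarnessLib

/-!
# PINNING-FIELD rows: the ZERO-MOMENTUM DOUBLE-COMMUTATOR HOOK — the Ward–Bogoliubov border block of the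
# pair-sourced torus, entry by entry, as translation-averaged expectations of WINDOW words

HONEST FRAMING: soundness glue only; zero compute; nothing here is a number, an order parameter or a phase word. A
border row is a constraint valid in every ground state of the SOURCED problem at fixed `h > 0` (T1 / W1).

WHAT THIS FILE IS (cell `hubbard-cq`, card `sourced-kkt-one-point-floor`, addendum «ward-bogoliubov-border-rows»,
census (41); lead ASSIGN 2026-08-27T00:08Z to seat `hubbard-cq-p1`; sequel of `Observables/WardBogoliubovBorder.lean`
and companion of `Rows/SourcedTorusRowsKKTHook.lean`). The border's generators are TORUS-WIDE zero-momentum sums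
`𝒴_b = Σ_v T_v Γ(Y_b)` of window words `Y_b ∈ 𝔄_Λ` (`T_v = relabel (Orb.translate v)`, `Γ = Γ(ι_{Λ,L})`; the Ward
generator `N/2` is the case `Y = ½Σ_σ n_{0σ}`), so their `kktForm` parents are non-local, while the DOUBLE commutator is
local. This file proves, for the pair-sourced `t–t'` torus `A_L = dWaveSourceTorusTT' L tp U μ h`:

* §1 `relabel_translate_dWaveSourceTorusTT'` (translation invariance of `A_L`) and
  `dWaveSourceTorusTT'_commutator_sum_relabel_translate`: `[A_L, 𝒴_b] = Σ_w T_w Γ_{Λ'}(C_b)` with the WINDOW word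
  `C_b := H^{src,tt'}_{Λ'} Ỹ_b − Ỹ_b H^{src,tt'}_{Λ'} ∈ 𝔄_{Λ'}` (`Ỹ_b = Γ(incl) Y_b`, `thicken Λ 1 ⊆ Λ'`; locality
  `dWaveSourceTorusTT'_commutator_fermionEmbed` term by term).
* §2 `expect_borderBlock_entry`: for `(Y_a)ᴴ` EVEN, an offset set `Z ∋ c − a` (`a ∈ Λ`, `c ∈ Λ'`) and a region
  `Ω ⊇ Λ', Λ + z (z ∈ Z)` fitting into the torus,
  `⟨ψ, (𝒴_aᴴ[A_L,𝒴_b] − [A_L,𝒴_b]𝒴_aᴴ)ψ⟩ = L² · torusAvgExpectAt L Ω (commDensity Ω Z (Y_a)ᴴ C_b) ψ`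
  — the torus block entry is `L²` times the translation-averaged expectation of the LOCAL commutator density
  `Σ_{z∈Z}[τ_z (Y_a)ᴴ, C_b] ∈ 𝔄_Ω` (`FermionTorusTranslationSums.expect_commutator_sum_relabel_translate`).
* §3 THE HOOK `posSemidef_borderBlock_torusAvg`: for every ground-state vector `ψ` of `A_L` (full Fock space) and every
  finite family of window words `Y : β → 𝔄_Λ` with even adjoints, the matrix
  `(torusAvgExpectAt L Ω (commDensity Ω Z (Y a)ᴴ C_b) ψ)_{ab}` is `PosSemidef` (it is `L⁻²` times the torus block of
  `Observables.posSemidef_doubleCommutatorBlock` for the torus-wide generators `𝒴_b`), and the READER form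
  `re_sum_mul_torusAvg_borderBlock_nonneg`: `0 ≤ Re Σ_ab Γm_ab · torusAvgExpectAt L Ω (D_ab) ψ` for every multiplier
  `Γm ⪰ 0` — i.e. a window certificate may carry the extra summand `Σ_ab Γm_ab • D_ab` (`D_ab ∈ 𝔄_Ω` the commutator
  densities) on its right-hand side, sound in the translation-averaged state of every ground vector, exactly like the
  `kktForm` summand of `SourcedTorusRowsKKTHook` (whose state `orbitState (spaceGroupUnitary {1}) ψ ∘ Γ` is this
  translation average, `orbitState_spaceGroupUnitary_fermionEmbed_toTorusEmb`).

* §4 (appended): `orbitState_singleton_one_fermionEmbed_eq_torusAvgExpectAt` (the Rows files' state at `S = {1}` IS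
  `torusAvgExpectAt`) and `re_orbitState_borderForm_nonneg` (the hook in the `SourcedTorusRowsKKTHook` vocabulary).

Which words: the reader discharges `(Y a)ᴴ ∈ carEvenSubalgebra univ` per word (densities, hoppings, pair words and the
Ward word `½Σ_σ n_{0σ}` are even with even adjoints). The Ward evaluation of the `(N/2, N/2)` entry (`= h·⟨Δ_d + Δ_dᴴ⟩`,
`Observables.ward_doubleCommutator`) and of the torque entries is window algebra left to the certificate (the densities
differ from `h(P₀ + P₀ᴴ)` etc. by affine defects `τ_z X − X`, which the identity format already carries).

NOTHING IS ASSERTED beyond soundness; no certificate, no number, no `sorry`, no named fact, no definition. Elaborated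
with the LIBRARY instances at the concrete torus (as `FermionTorusTranslationSums`); a consumer stated under the Rows
files' local `DecidableEq (FermionTorus 2 L)` instance bridges by `convert … using _` (`Subsingleton.elim`).

References: L. Pitaevskii, S. Stringari, J. Low Temp. Phys. 85 (1991) 377, §2 [PitaevskiiStringari1991]; O. Bratteli,
D. W. Robinson II (1997), §6.2.1 and Prop. 5.3.19 [BratteliRobinsonII1997]; T. Koma, H. Tasaki, J. Stat. Phys. 76 (1994)
745, §1 [KomaTasaki1994].
-/

noncomputable section

namespace Summit.Ventures.CertifiedManyBodySolver

open Literature.MathematicalPhysics.QuantumLattice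
open Matrix HubbardWave0 Literature.Probability.LatticeModels Finset
open scoped BigOperators ComplexOrder

variable {L : ℕ} [NeZero L]

/-! ## §1 Translation invariance of the pair-sourced torus and the commutator with a translation sum -/

/-- **Translation invariance of the pair-sourced `t–t'` torus**: `T_v A_L T_v⁻¹ = A_L`
(`relabel_translate_hubbardTorusTT'`, `relabel_mapEquiv_totalNumber`, `relabel_translate_pairField`).
[cite: KomaTasaki1994, §1] -/
theorem relabel_translate_dWaveSourceTorusTT' (v : TorusSite 2 L) (tp U μ h : ℝ) :
    relabel (Orb.translate v) (dWaveSourceTorusTT' L tp U μ h) = dWaveSourceTorusTT' L tp U μ h := by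
  have hN : relabel (Orb.translate v)
      (totalNumber : Matrix (Finset (Orb (FermionTorus 2 L))) (Finset (Orb (FermionTorus 2 L))) ℂ) = totalNumber := by
    rw [Orb.translate, relabel_mapEquiv_totalNumber]
  rw [dWaveSourceTorusTT', relabel_sub, relabel_sub, relabel_smul, relabel_smul, relabel_add, relabel_conjTranspose,
    relabel_translate_hubbardTorusTT', hN, relabel_translate_pairField]

/-- **The commutator of the pair-sourced torus with a translation sum of an embedded window word is the translation
sum of the embedded WINDOW commutator**: for `B ∈ 𝔄_Λ`, `thicken Λ 1 ⊆ Λ'`, `x ↦ x mod L` injective on `thicken Λ' 1`: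
`A_L (Σ_v T_v Γ B̃) − (Σ_v T_v Γ B̃) A_L = Σ_v T_v Γ(H^{src,tt'}_{Λ'} B̃ − B̃ H^{src,tt'}_{Λ'})`, `B̃ = Γ(incl) B`.
[cite: BratteliRobinsonII1997, Thm. 6.2.4] -/
theorem dWaveSourceTorusTT'_commutator_sum_relabel_translate (tp U μ h : ℝ) {Λ Λ' : Finset (Site 2)}
    (hΛ : Λ ⊆ Λ') (h8 : thicken Λ 1 ⊆ Λ') (hInj : Set.InjOn (Torus.proj (d := 2) L) ↑(thicken Λ' 1))
    (B : FermionOp Λ) :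
    dWaveSourceTorusTT' L tp U μ h *
          (∑ v : TorusSite 2 L, relabel (Orb.translate v)
            (fermionEmbed (PolySite.toTorusEmb L (hInj.mono (by exact_mod_cast subset_thicken Λ' 1)))
              (fermionEmbed (PolySite.incl hΛ) B))) -
        (∑ v : TorusSite 2 L, relabel (Orb.translate v)
            (fermionEmbed (PolySite.toTorusEmb L (hInj.mono (by exact_mod_cast subset_thicken Λ' 1)))
              (fermionEmbed (PolySite.incl hΛ) B))) * dWaveSourceTorusTT' L tp U μ h =
      ∑ v : TorusSite 2 L, relabel (Orb.translate v)
        (fermionEmbed (PolySite.toTorusEmb L (hInj.mono (by exact_mod_cast subset_thicken Λ' 1)))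
          (pairSourceWindowHamiltonianTT' dWaveFormFactor Λ' tp U μ h * fermionEmbed (PolySite.incl hΛ) B -
            fermionEmbed (PolySite.incl hΛ) B * pairSourceWindowHamiltonianTT' dWaveFormFactor Λ' tp U μ h)) := by
  rw [Finset.mul_sum, Finset.sum_mul, ← Finset.sum_sub_distrib]
  refine Finset.sum_congr rfl fun v _ => ?_
  rw [← dWaveSourceTorusTT'_commutator_fermionEmbed L hΛ h8 hInj tp U μ h B, relabel_sub, relabel_mul, relabel_mul,
    relabel_translate_dWaveSourceTorusTT']

/-! ## §2 The torus block entry as `L²` times a translation-averaged window word -/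

section Entry

variable (tp U μ h : ℝ) {Λ Λ' Ω Z : Finset (Site 2)}

/-- **Border block entry.** Let `Λ ⊆ Λ'` with `thicken Λ 1 ⊆ Λ'`, `Λ' ⊆ Ω`, `Λ + z ⊆ Ω` for `z ∈ Z`,
`Z ∋ c − a` for all `a ∈ Λ`, `c ∈ Λ'`, `x ↦ x mod L` injective on `thicken Λ' 1`, on `Ω` and on `Z`; let `Y_a, Y_b ∈ 𝔄_Λ`
with `(Y_a)ᴴ` EVEN, `𝒴 = Σ_v T_v Γ(·)` their translation sums and `C_b = H^{src,tt'}_{Λ'} Ỹ_b − Ỹ_b H^{src,tt'}_{Λ'}`.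
Then `⟨ψ, (𝒴_aᴴ (A_L 𝒴_b − 𝒴_b A_L) − (A_L 𝒴_b − 𝒴_b A_L) 𝒴_aᴴ) ψ⟩ = L² · torusAvgExpectAt L Ω (commDensity Ω Z (Y_a)ᴴ C_b) ψ`.
[cite: BratteliRobinsonII1997, §6.2.1] [cite: PitaevskiiStringari1991, §2] -/
theorem expect_borderBlock_entry (hΛ : Λ ⊆ Λ') (h8 : thicken Λ 1 ⊆ Λ') (hΛ'Ω : Λ' ⊆ Ω)
    (hInj : Set.InjOn (Torus.proj (d := 2) L) ↑(thicken Λ' 1))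
    (hΩ : Set.InjOn (Torus.proj (d := 2) L) ↑Ω) (hZinj : Set.InjOn (Torus.proj (d := 2) L) ↑Z)
    (hZ : ∀ z ∈ Z, shiftSet z Λ ⊆ Ω) (hcomplete : ∀ a ∈ Λ, ∀ c ∈ Λ', c - a ∈ Z)
    (Ya Yb : FermionOp Λ) (hYa : Yaᴴ ∈ carEvenSubalgebra (Finset.univ : Finset (Orb (PolySite Λ))))
    (ψ : Fock (Orb (FermionTorus 2 L))) :
    expect
        ((∑ v : TorusSite 2 L, relabel (Orb.translate v)
            (fermionEmbed (PolySite.toTorusEmb L (hΩ.mono (Finset.coe_subset.2 (hΛ.trans hΛ'Ω)))) Ya))ᴴ *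
            (dWaveSourceTorusTT' L tp U μ h *
                (∑ v : TorusSite 2 L, relabel (Orb.translate v)
                  (fermionEmbed (PolySite.toTorusEmb L (hΩ.mono (Finset.coe_subset.2 (hΛ.trans hΛ'Ω)))) Yb)) -
              (∑ v : TorusSite 2 L, relabel (Orb.translate v)
                  (fermionEmbed (PolySite.toTorusEmb L (hΩ.mono (Finset.coe_subset.2 (hΛ.trans hΛ'Ω)))) Yb)) *
                dWaveSourceTorusTT' L tp U μ h) -
          (dWaveSourceTorusTT' L tp U μ h *
                (∑ v : TorusSite 2 L, relabel (Orb.translate v)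
                  (fermionEmbed (PolySite.toTorusEmb L (hΩ.mono (Finset.coe_subset.2 (hΛ.trans hΛ'Ω)))) Yb)) -
              (∑ v : TorusSite 2 L, relabel (Orb.translate v)
                  (fermionEmbed (PolySite.toTorusEmb L (hΩ.mono (Finset.coe_subset.2 (hΛ.trans hΛ'Ω)))) Yb)) *
                dWaveSourceTorusTT' L tp U μ h) *
            (∑ v : TorusSite 2 L, relabel (Orb.translate v)
              (fermionEmbed (PolySite.toTorusEmb L (hΩ.mono (Finset.coe_subset.2 (hΛ.trans hΛ'Ω)))) Ya))ᴴ) ψ =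
      ((L : ℂ) ^ 2) *
        torusAvgExpectAt L Ω
          (commDensity Ω Z hΛ'Ω Yaᴴ
            (pairSourceWindowHamiltonianTT' dWaveFormFactor Λ' tp U μ h * fermionEmbed (PolySite.incl hΛ) Yb -
              fermionEmbed (PolySite.incl hΛ) Yb * pairSourceWindowHamiltonianTT' dWaveFormFactor Λ' tp U μ h)) ψ := by
  have hInj' : Set.InjOn (Torus.proj (d := 2) L) ↑Λ' := hInj.mono (by exact_mod_cast subset_thicken Λ' 1)
  -- the translation sum of `Y_b` through `Λ'` (same operator, embeddings compose)
  have hemb : ∀ X : FermionOp Λ,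
      fermionEmbed (PolySite.toTorusEmb L (hΩ.mono (Finset.coe_subset.2 (hΛ.trans hΛ'Ω)))) X =
        fermionEmbed (PolySite.toTorusEmb L (hInj.mono (by exact_mod_cast subset_thicken Λ' 1)))
          (fermionEmbed (PolySite.incl hΛ) X) := by
    intro X
    rw [fermionEmbed_fermionEmbed (PolySite.incl hΛ)]
    congr 1
  -- `[A_L, 𝒴_b]` is the translation sum of `Γ_{Λ'} C_b`
  have hcomm : dWaveSourceTorusTT' L tp U μ h *
        (∑ v : TorusSite 2 L, relabel (Orb.translate v)
          (fermionEmbed (PolySite.toTorusEmb L (hΩ.mono (Finset.coe_subset.2 (hΛ.trans hΛ'Ω)))) Yb)) -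
      (∑ v : TorusSite 2 L, relabel (Orb.translate v)
          (fermionEmbed (PolySite.toTorusEmb L (hΩ.mono (Finset.coe_subset.2 (hΛ.trans hΛ'Ω)))) Yb)) *
        dWaveSourceTorusTT' L tp U μ h =
      ∑ v : TorusSite 2 L, relabel (Orb.translate v)
        (fermionEmbed (PolySite.toTorusEmb L (hΩ.mono (Finset.coe_subset.2 hΛ'Ω)))
          (pairSourceWindowHamiltonianTT' dWaveFormFactor Λ' tp U μ h * fermionEmbed (PolySite.incl hΛ) Yb -
            fermionEmbed (PolySite.incl hΛ) Yb * pairSourceWindowHamiltonianTT' dWaveFormFactor Λ' tp U μ h)) := by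
    simp_rw [hemb Yb]
    rw [dWaveSourceTorusTT'_commutator_sum_relabel_translate tp U μ h hΛ h8 hInj Yb]
  -- `𝒴_aᴴ` is the translation sum of `Γ((Y_a)ᴴ)`
  have hadj : (∑ v : TorusSite 2 L, relabel (Orb.translate v)
      (fermionEmbed (PolySite.toTorusEmb L (hΩ.mono (Finset.coe_subset.2 (hΛ.trans hΛ'Ω)))) Ya))ᴴ =
      ∑ v : TorusSite 2 L, relabel (Orb.translate v)
        (fermionEmbed (PolySite.toTorusEmb L (hΩ.mono (Finset.coe_subset.2 (hΛ.trans hΛ'Ω)))) Yaᴴ) := by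
    rw [conjTranspose_sum]
    refine Finset.sum_congr rfl fun v _ => ?_
    rw [← relabel_conjTranspose, fermionEmbed_conjTranspose]
  rw [hcomm, hadj]
  exact expect_commutator_sum_relabel_translate L hΩ hZinj (hΛ.trans hΛ'Ω) hΛ'Ω hZ hcomplete hYa _ ψ

end Entry

/-! ## §3 THE HOOK: the border block of translation-averaged window words is positive semidefinite -/

section Hook

variable (tp U μ h : ℝ) {Λ Λ' Ω Z : Finset (Site 2)}

/-- **Zero-momentum double-commutator HOOK.** Under the geometric hypotheses of `expect_borderBlock_entry`, for every
finite family of window words `Y : β → 𝔄_Λ` with EVEN adjoints and every ground-state vector `ψ` of the pair-sourced torus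
`A_L = dWaveSourceTorusTT' L tp U μ h` (full Fock space), the matrix of translation-averaged commutator densities
`(torusAvgExpectAt L Ω (commDensity Ω Z (Y a)ᴴ C_b) ψ)_{ab}`, `C_b = H^{src,tt'}_{Λ'} Ỹ_b − Ỹ_b H^{src,tt'}_{Λ'}`, is
positive semidefinite — it is `L⁻²` times the `k = 0` double-commutator block of the torus-wide generators `𝒴_b`
(`Observables.posSemidef_doubleCommutatorBlock`). [cite: PitaevskiiStringari1991, §2] [cite: BratteliRobinsonII1997, Prop. 5.3.19] -/
theorem posSemidef_borderBlock_torusAvg (hΛ : Λ ⊆ Λ') (h8 : thicken Λ 1 ⊆ Λ') (hΛ'Ω : Λ' ⊆ Ω)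
    (hInj : Set.InjOn (Torus.proj (d := 2) L) ↑(thicken Λ' 1))
    (hΩ : Set.InjOn (Torus.proj (d := 2) L) ↑Ω) (hZinj : Set.InjOn (Torus.proj (d := 2) L) ↑Z)
    (hZ : ∀ z ∈ Z, shiftSet z Λ ⊆ Ω) (hcomplete : ∀ a ∈ Λ, ∀ c ∈ Λ', c - a ∈ Z)
    {β : Type*} [Fintype β] (Y : β → FermionOp Λ)
    (hY : ∀ b, (Y b)ᴴ ∈ carEvenSubalgebra (Finset.univ : Finset (Orb (PolySite Λ))))
    {ψ : Fock (Orb (FermionTorus 2 L))} (hψ : (dWaveSourceTorusTT' L tp U μ h).IsGroundStateVector ψ) :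
    (Matrix.of fun a b : β =>
      torusAvgExpectAt L Ω
        (commDensity Ω Z hΛ'Ω (Y a)ᴴ
          (pairSourceWindowHamiltonianTT' dWaveFormFactor Λ' tp U μ h * fermionEmbed (PolySite.incl hΛ) (Y b) -
            fermionEmbed (PolySite.incl hΛ) (Y b) * pairSourceWindowHamiltonianTT' dWaveFormFactor Λ' tp U μ h)) ψ).PosSemidef := by
  set A := dWaveSourceTorusTT' L tp U μ h with hA
  have hAh : A.IsHermitian := dWaveSourceTorusTT'_isHermitian L tp U μ h
  -- the torus-wide generators
  set X : β → Matrix (Finset (Orb (FermionTorus 2 L))) (Finset (Orb (FermionTorus 2 L))) ℂ := fun b =>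
    ∑ v : TorusSite 2 L, relabel (Orb.translate v)
      (fermionEmbed (PolySite.toTorusEmb L (hΩ.mono (Finset.coe_subset.2 (hΛ.trans hΛ'Ω)))) (Y b)) with hX
  have hblock := Observables.posSemidef_doubleCommutatorBlock hAh hψ X
  have hL : (0 : ℝ) < (L : ℝ) ^ 2 := by
    have : (0 : ℝ) < (L : ℝ) := by exact_mod_cast Nat.pos_of_ne_zero (NeZero.ne L)
    positivity
  have hL0 : ((L : ℂ) ^ 2) ≠ 0 := by exact_mod_cast hL.ne'
  have hdec : (Matrix.of fun a b : β =>
      torusAvgExpectAt L Ω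
        (commDensity Ω Z hΛ'Ω (Y a)ᴴ
          (pairSourceWindowHamiltonianTT' dWaveFormFactor Λ' tp U μ h * fermionEmbed (PolySite.incl hΛ) (Y b) -
            fermionEmbed (PolySite.incl hΛ) (Y b) * pairSourceWindowHamiltonianTT' dWaveFormFactor Λ' tp U μ h)) ψ) =
      (((L : ℂ) ^ 2)⁻¹) • (Matrix.of fun a b : β =>
        star ψ ⬝ᵥ ((X a)ᴴ * (A * X b - X b * A) - (A * X b - X b * A) * (X a)ᴴ) *ᵥ ψ) := by
    ext a b
    rw [Matrix.smul_apply, Matrix.of_apply, Matrix.of_apply, smul_eq_mul]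
    have he := expect_borderBlock_entry tp U μ h hΛ h8 hΛ'Ω hInj hΩ hZinj hZ hcomplete (Y a) (Y b) (hY a) ψ
    rw [Literature.MathematicalPhysics.QuantumLattice.expect] at he
    rw [he, ← mul_assoc, inv_mul_cancel₀ hL0, one_mul]
  rw [hdec]
  refine hblock.smul ?_
  rw [← Complex.ofReal_natCast, ← Complex.ofReal_pow, ← Complex.ofReal_inv]
  exact Complex.zero_le_real.2 (inv_nonneg.2 hL.le)

/-- **READER form of the hook.** Under the same hypotheses, for every multiplier `Γm ⪰ 0` on the word index set:
`0 ≤ Re Σ_a Σ_b Γm a b · torusAvgExpectAt L Ω (D a b) ψ`, `D a b = commDensity Ω Z (Y a)ᴴ C_b` — the summand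
`Σ_ab Γm_ab • D_ab ∈ 𝔄_Ω` is an admissible nonnegative residual of a window-certificate identity read in the
translation-averaged state of any ground vector of the sourced torus (pairing of two positive semidefinite matrices,
`re_trace_mul_nonneg_of_posSemidef`). [cite: PitaevskiiStringari1991, §2] -/
theorem re_sum_mul_torusAvg_borderBlock_nonneg (hΛ : Λ ⊆ Λ') (h8 : thicken Λ 1 ⊆ Λ') (hΛ'Ω : Λ' ⊆ Ω)
    (hInj : Set.InjOn (Torus.proj (d := 2) L) ↑(thicken Λ' 1))
    (hΩ : Set.InjOn (Torus.proj (d := 2) L) ↑Ω) (hZinj : Set.InjOn (Torus.proj (d := 2) L) ↑Z)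
    (hZ : ∀ z ∈ Z, shiftSet z Λ ⊆ Ω) (hcomplete : ∀ a ∈ Λ, ∀ c ∈ Λ', c - a ∈ Z)
    {β : Type*} [Fintype β] [DecidableEq β] (Y : β → FermionOp Λ)
    (hY : ∀ b, (Y b)ᴴ ∈ carEvenSubalgebra (Finset.univ : Finset (Orb (PolySite Λ))))
    {Γm : Matrix β β ℂ} (hΓm : Γm.PosSemidef)
    {ψ : Fock (Orb (FermionTorus 2 L))} (hψ : (dWaveSourceTorusTT' L tp U μ h).IsGroundStateVector ψ) :
    0 ≤ (∑ a, ∑ b, Γm a b *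
      torusAvgExpectAt L Ω
        (commDensity Ω Z hΛ'Ω (Y a)ᴴ
          (pairSourceWindowHamiltonianTT' dWaveFormFactor Λ' tp U μ h * fermionEmbed (PolySite.incl hΛ) (Y b) -
            fermionEmbed (PolySite.incl hΛ) (Y b) * pairSourceWindowHamiltonianTT' dWaveFormFactor Λ' tp U μ h)) ψ).re := by
  have hM := posSemidef_borderBlock_torusAvg tp U μ h hΛ h8 hΛ'Ω hInj hΩ hZinj hZ hcomplete Y hY hψ
  set M := (Matrix.of fun a b : β =>
      torusAvgExpectAt L Ω
        (commDensity Ω Z hΛ'Ω (Y a)ᴴ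
          (pairSourceWindowHamiltonianTT' dWaveFormFactor Λ' tp U μ h * fermionEmbed (PolySite.incl hΛ) (Y b) -
            fermionEmbed (PolySite.incl hΛ) (Y b) * pairSourceWindowHamiltonianTT' dWaveFormFactor Λ' tp U μ h)) ψ) with hMdef
  have htr : (∑ a, ∑ b, Γm a b * M a b) = (Γm * Mᵀ).trace := by
    simp only [Matrix.trace, Matrix.diag, Matrix.mul_apply, Matrix.transpose_apply]
  have e : (∑ a, ∑ b, Γm a b *
      torusAvgExpectAt L Ω
        (commDensity Ω Z hΛ'Ω (Y a)ᴴ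
          (pairSourceWindowHamiltonianTT' dWaveFormFactor Λ' tp U μ h * fermionEmbed (PolySite.incl hΛ) (Y b) -
            fermionEmbed (PolySite.incl hΛ) (Y b) * pairSourceWindowHamiltonianTT' dWaveFormFactor Λ' tp U μ h)) ψ) =
      ∑ a, ∑ b, Γm a b * M a b := by
    simp only [hMdef, Matrix.of_apply]
  rw [e, htr]
  exact Literature.LinearAlgebra.Matrix.re_trace_mul_nonneg_of_posSemidef hΓm hM.transpose

/-- **The hook with the multiplier summed inside the state** (the shape of a certificate summand): the window operator
`Σ_a Σ_b Γm a b • D a b ∈ 𝔄_Ω` has nonnegative real translation-averaged expectation in every ground vector.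
[cite: PitaevskiiStringari1991, §2] -/
theorem re_torusAvg_borderForm_nonneg (hΛ : Λ ⊆ Λ') (h8 : thicken Λ 1 ⊆ Λ') (hΛ'Ω : Λ' ⊆ Ω)
    (hInj : Set.InjOn (Torus.proj (d := 2) L) ↑(thicken Λ' 1))
    (hΩ : Set.InjOn (Torus.proj (d := 2) L) ↑Ω) (hZinj : Set.InjOn (Torus.proj (d := 2) L) ↑Z)
    (hZ : ∀ z ∈ Z, shiftSet z Λ ⊆ Ω) (hcomplete : ∀ a ∈ Λ, ∀ c ∈ Λ', c - a ∈ Z)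
    {β : Type*} [Fintype β] [DecidableEq β] (Y : β → FermionOp Λ)
    (hY : ∀ b, (Y b)ᴴ ∈ carEvenSubalgebra (Finset.univ : Finset (Orb (PolySite Λ))))
    {Γm : Matrix β β ℂ} (hΓm : Γm.PosSemidef)
    {ψ : Fock (Orb (FermionTorus 2 L))} (hψ : (dWaveSourceTorusTT' L tp U μ h).IsGroundStateVector ψ) :
    0 ≤ (torusAvgExpectAt L Ω (∑ a, ∑ b, Γm a b •
        commDensity Ω Z hΛ'Ω (Y a)ᴴ
          (pairSourceWindowHamiltonianTT' dWaveFormFactor Λ' tp U μ h * fermionEmbed (PolySite.incl hΛ) (Y b) -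
            fermionEmbed (PolySite.incl hΛ) (Y b) * pairSourceWindowHamiltonianTT' dWaveFormFactor Λ' tp U μ h)) ψ).re := by
  have hlin : torusAvgExpectAt L Ω (∑ a, ∑ b, Γm a b •
        commDensity Ω Z hΛ'Ω (Y a)ᴴ
          (pairSourceWindowHamiltonianTT' dWaveFormFactor Λ' tp U μ h * fermionEmbed (PolySite.incl hΛ) (Y b) -
            fermionEmbed (PolySite.incl hΛ) (Y b) * pairSourceWindowHamiltonianTT' dWaveFormFactor Λ' tp U μ h)) ψ =
      ∑ a, ∑ b, Γm a b * torusAvgExpectAt L Ω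
        (commDensity Ω Z hΛ'Ω (Y a)ᴴ
          (pairSourceWindowHamiltonianTT' dWaveFormFactor Λ' tp U μ h * fermionEmbed (PolySite.incl hΛ) (Y b) -
            fermionEmbed (PolySite.incl hΛ) (Y b) * pairSourceWindowHamiltonianTT' dWaveFormFactor Λ' tp U μ h)) ψ := by
    rw [← Finset.sum_product' (s := (Finset.univ : Finset β)) (t := (Finset.univ : Finset β))
      (f := fun a b => Γm a b • commDensity Ω Z hΛ'Ω (Y a)ᴴ
          (pairSourceWindowHamiltonianTT' dWaveFormFactor Λ' tp U μ h * fermionEmbed (PolySite.incl hΛ) (Y b) -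
            fermionEmbed (PolySite.incl hΛ) (Y b) * pairSourceWindowHamiltonianTT' dWaveFormFactor Λ' tp U μ h)),
      torusAvgExpectAt_sum_smul, Finset.sum_product]
  rw [hlin]
  exact re_sum_mul_torusAvg_borderBlock_nonneg tp U μ h hΛ h8 hΛ'Ω hInj hΩ hZinj hZ hcomplete Y hY hΓm hψ

end Hook

/-! ## §4 The same in the Rows vocabulary: the orbit state at `S = {1}` (appended 2026-08-27) -/

section OrbitState

open Literature.MathematicalPhysics.QuantumManyBody.StateRelaxation

variable (tp U μ h : ℝ) {Λ Λ' Ω Z : Finset (Site 2)}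

/-- **The translation-averaged vector state of the Rows files IS `torusAvgExpectAt`**: for the trivial point group
`S = {1}`, `orbitState (spaceGroupUnitary {1}) ψ (Γ_Ω D) = torusAvgExpectAt L Ω D ψ` (`L²·ω̄_ψ(X) = ⟨ψ,(Σ_w U_w X U_wᴴ)ψ⟩`,
`U_w X U_wᴴ = T_w X`, and the translation sum of an embedded window word has expectation `L²·torusAvgExpectAt`).
[cite: BratteliRobinsonI1987, §4.3.1] -/
theorem orbitState_singleton_one_fermionEmbed_eq_torusAvgExpectAt (hΩ : Set.InjOn (Torus.proj (d := 2) L) ↑Ω)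
    (D : FermionOp Ω) (ψ : Fock (Orb (FermionTorus 2 L))) :
    orbitState (spaceGroupUnitary ({1} : Finset (DihedralGroup 4))) ψ (fermionEmbed (PolySite.toTorusEmb L hΩ) D) =
      torusAvgExpectAt L Ω D ψ := by
  have hL : ((L ^ 2 : ℕ) : ℂ) ≠ 0 := by exact_mod_cast pow_ne_zero 2 (NeZero.ne L)
  have h1 := sq_mul_orbitState_singleton_one_eq ψ (fermionEmbed (PolySite.toTorusEmb L hΩ) D)
  have hsum : (∑ w : TorusSite 2 L, (fockTranslate w).val * fermionEmbed (PolySite.toTorusEmb L hΩ) D *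
      (fockTranslate w).valᴴ) =
      ∑ v : TorusSite 2 L, relabel (Orb.translate v) (fermionEmbed (PolySite.toTorusEmb L hΩ) D) := by
    refine Finset.sum_congr rfl fun w _ => ?_
    rw [relabel_eq_fockRelabel_conj]
  have h2 := expect_sum_relabel_translate_fermionEmbed' L hΩ D ψ
  rw [Literature.MathematicalPhysics.QuantumLattice.expect, ← hsum] at h2
  -- `L² · ω̄(ΓD) = ⟨ψ, Σ_w U_w ΓD U_wᴴ ψ⟩ = L² · torusAvg`
  have h3 : ((L ^ 2 : ℕ) : ℂ) * orbitState (spaceGroupUnitary ({1} : Finset (DihedralGroup 4))) ψ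
      (fermionEmbed (PolySite.toTorusEmb L hΩ) D) = ((L ^ 2 : ℕ) : ℂ) * torusAvgExpectAt L Ω D ψ := by
    rw [h1]
    convert h2 using 2
    push_cast
    ring
  exact mul_left_cancel₀ hL h3

/-- **The hook in the Rows vocabulary (`S = {1}`).** Under the hypotheses of `posSemidef_borderBlock_torusAvg` and for
every multiplier `Γm ⪰ 0`: `0 ≤ Re ω̄_ψ(Γ_Ω(Σ_ab Γm_ab • D_ab))`, `ω̄_ψ = orbitState (spaceGroupUnitary {1}) ψ`,
`D_ab = commDensity Ω Z (Y a)ᴴ (H^{src,tt'}_{Λ'}Ỹ_b − Ỹ_bH^{src,tt'}_{Λ'})` — the border summand is an admissible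
nonnegative residual of a window-certificate identity read, as in `SourcedTorusRowsKKTHook`, in the orbit state of every
ground vector of the pair-sourced torus (translation average; point-group reductions `S ≠ {1}` not covered here).
[cite: PitaevskiiStringari1991, §2] [cite: BratteliRobinsonII1997, Prop. 5.3.19] -/
theorem re_orbitState_borderForm_nonneg (hΛ : Λ ⊆ Λ') (h8 : thicken Λ 1 ⊆ Λ') (hΛ'Ω : Λ' ⊆ Ω)
    (hInj : Set.InjOn (Torus.proj (d := 2) L) ↑(thicken Λ' 1))
    (hΩ : Set.InjOn (Torus.proj (d := 2) L) ↑Ω) (hZinj : Set.InjOn (Torus.proj (d := 2) L) ↑Z)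
    (hZ : ∀ z ∈ Z, shiftSet z Λ ⊆ Ω) (hcomplete : ∀ a ∈ Λ, ∀ c ∈ Λ', c - a ∈ Z)
    {β : Type*} [Fintype β] [DecidableEq β] (Y : β → FermionOp Λ)
    (hY : ∀ b, (Y b)ᴴ ∈ carEvenSubalgebra (Finset.univ : Finset (Orb (PolySite Λ))))
    {Γm : Matrix β β ℂ} (hΓm : Γm.PosSemidef)
    {ψ : Fock (Orb (FermionTorus 2 L))} (hψ : (dWaveSourceTorusTT' L tp U μ h).IsGroundStateVector ψ) :
    0 ≤ (orbitState (spaceGroupUnitary ({1} : Finset (DihedralGroup 4))) ψ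
      (fermionEmbed (PolySite.toTorusEmb L hΩ) (∑ a, ∑ b, Γm a b •
        commDensity Ω Z hΛ'Ω (Y a)ᴴ
          (pairSourceWindowHamiltonianTT' dWaveFormFactor Λ' tp U μ h * fermionEmbed (PolySite.incl hΛ) (Y b) -
            fermionEmbed (PolySite.incl hΛ) (Y b) * pairSourceWindowHamiltonianTT' dWaveFormFactor Λ' tp U μ h)))).re := by
  rw [orbitState_singleton_one_fermionEmbed_eq_torusAvgExpectAt]
  exact re_torusAvg_borderForm_nonneg tp U μ h hΛ h8 hΛ'Ω hInj hΩ hZinj hZ hcomplete Y hY hΓm hψ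

end OrbitState

end Summit.Ventures.CertifiedManyBodySolver

end
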